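import Summits.CriticalPhenomena.PercolationContinuityZ3.Theorems.SahiMasterFamilyPointwiseAlmostEverywhere
import Summits.CriticalPhenomena.PercolationContinuityZ3.Theorems.SahiMasterFamilyPointwiseLower

/-!
# Almost every parameter vector, II: arbitrary finite coordinate sets, DECREASING families, and the graph form

Unit `prim-master-conj` (crux anchor stmt-CriticalPhenomena-4575, helper work), gen 13; companion of `SahiMasterFamilyPointwiseAlmostEverywhere.lean`
(there: `Fin n` coordinates, increasing families).  Relabelling the coordinates (`MvPolynomial.rename`, the measure-preserving
`MeasurableEquiv.piCongrLeft`) and the decreasing-side (EQI-k) (`sahiE_ind_lower_identically_zero_iff`) give: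

* `volume_cube_zeroSet_eq_zero'` — on any non-empty finite index type `ι`, a real polynomial not vanishing identically on `[0,1]^ι` has a
  Lebesgue-null zero set there;
* `volume_cube_sahiE_zeroSet_eq_zero'` / `volume_cube_sahiE_lower_zeroSet_eq_zero` — for increasing (resp. DECREASING) `U ∉ Z_k` on `ι`,
  `{x ∈ [0,1]^ι : E_k(μ_x; 1_U) = 0}` is Lebesgue-null;
* `ae_forall_sahiE_eq_zero_iff'`, `ae_forall_sahiE_lower_eq_zero_iff` — **for a.e. `x ∈ [0,1]^ι`, every increasing (resp. decreasing) `k`-family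
  satisfies `E_k(μ_x; 1_U) = 0 ↔ U ∈ Z_k`**;
* **GRAPH FORM** `ae_forall_groupSep_sahiE_eq_zero_iff` — for every finite graph and every `k`: **for Lebesgue-almost every edge-weight vector
  `w ∈ [0,1]^{E}`, a `k`-tuple of group separations `{X_j ↮ Y_j}` has `E_k(μ_w) = 0` iff it is a zero flag** (simultaneously for all tuples).
Axioms standard. [this work]
-/

noncomputable section

open scoped Classical ENNReal

namespace Summit.CriticalPhenomena.PercolationContinuityZ3.Theorems

open Finset Function MeasureTheory
open Literature.Combinatorics.Sahi2008
open Literature.Probability.Percolation.BHK2006 (weight)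
open Literature.Probability.Percolation.DecisionTree (ind)

namespace Pointwise

variable {ι : Type} [Fintype ι]

/-- **Null zero sets on any finite-dimensional cube**: a real polynomial in the variables `ι` (finite, non-empty) that does not vanish identically on
`[0,1]^ι` has a Lebesgue-null zero set in `[0,1]^ι` (transport of `volume_cube_zeroSet_eq_zero` along `ι ≃ Fin n`). [this work] -/
theorem volume_cube_zeroSet_eq_zero' [Nonempty ι] (P : MvPolynomial ι ℝ)
    (hne : ∃ x ∈ Set.pi Set.univ (fun _ : ι => Set.Icc (0 : ℝ) 1), MvPolynomial.eval x P ≠ 0) :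
    volume {x : ι → ℝ | x ∈ Set.pi Set.univ (fun _ : ι => Set.Icc (0 : ℝ) 1) ∧ MvPolynomial.eval x P = 0} = 0 := by
  set n := Fintype.card ι with hn
  have hn1 : 1 ≤ n := Fintype.card_pos
  set eqv : ι ≃ Fin n := Fintype.equivFin ι with heqv
  set T : (Fin n → ℝ) ≃ᵐ (ι → ℝ) := MeasurableEquiv.piCongrLeft (fun _ => ℝ) eqv.symm with hT
  have hTapply : ∀ (w : Fin n → ℝ) (k : ι), T w k = w (eqv k) := fun w k => by
    have := MeasurableEquiv.piCongrLeft_apply_apply (β := fun _ => ℝ) eqv.symm w (eqv k)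
    simpa [hT] using this
  have hTmp : MeasurePreserving T volume volume := volume_measurePreserving_piCongrLeft (fun _ => ℝ) eqv.symm
  -- the pulled-back set is the zero set of the renamed polynomial
  set Q : MvPolynomial (Fin n) ℝ := MvPolynomial.rename eqv P with hQ
  have hevalQ : ∀ w : Fin n → ℝ, MvPolynomial.eval w Q = MvPolynomial.eval (T w) P := by
    intro w
    have hweq : (w ∘ ⇑eqv) = T w := funext fun k => by rw [Function.comp_apply, hTapply]
    rw [hQ, MvPolynomial.eval_rename, hweq]
  have hpre : T ⁻¹' {x : ι → ℝ | x ∈ Set.pi Set.univ (fun _ : ι => Set.Icc (0 : ℝ) 1) ∧ MvPolynomial.eval x P = 0} =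
      {w : Fin n → ℝ | w ∈ Set.pi Set.univ (fun _ : Fin n => Set.Icc (0 : ℝ) 1) ∧ MvPolynomial.eval w Q = 0} := by
    ext w
    simp only [Set.mem_preimage, Set.mem_setOf_eq, Set.mem_univ_pi, hevalQ]
    constructor
    · rintro ⟨h1, h2⟩
      exact ⟨fun j => by have := h1 (eqv.symm j); rwa [hTapply, Equiv.apply_symm_apply] at this, h2⟩
    · rintro ⟨h1, h2⟩
      exact ⟨fun k => by rw [hTapply]; exact h1 (eqv k), h2⟩
  have hne' : ∃ w ∈ Set.pi Set.univ (fun _ : Fin n => Set.Icc (0 : ℝ) 1), MvPolynomial.eval w Q ≠ 0 := by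
    obtain ⟨x, hx, hx0⟩ := hne
    refine ⟨T.symm x, ?_, ?_⟩
    · rw [Set.mem_univ_pi]
      intro j
      have hxT : T (T.symm x) = x := T.apply_symm_apply x
      have := Set.mem_univ_pi.1 hx (eqv.symm j)
      rw [← hxT, hTapply, Equiv.apply_symm_apply] at this
      exact this
    · rw [hevalQ, T.apply_symm_apply]; exact hx0
  rw [← hTmp.measure_preimage_equiv, hpre]
  exact volume_cube_zeroSet_eq_zero hn1 Q hne'

/-- `E_k` under the product weight with real parameters, on any finite `ι`, is the evaluation of `sahiEPoly`. [this work] -/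
theorem eval_sahiEPoly_ind' {k : ℕ} (U : Fin k → Set (Set ι)) (x : ι → ℝ) :
    MvPolynomial.eval x (sahiEPoly k (fun j => ind (U j))) = sahiE (weight x) k (fun j => ind (U j)) :=
  eval_sahiEPoly x k _

/-- Null zero set from non-vanishing somewhere on the cube (any family of events, any finite `ι`). [this work] -/
theorem volume_cube_sahiE_zeroSet_eq_zero_of_exists {k : ℕ} (U : Fin k → Set (Set ι))
    (hne : ∃ x ∈ Set.pi Set.univ (fun _ : ι => Set.Icc (0 : ℝ) 1), sahiE (weight x) k (fun j => ind (U j)) ≠ 0) :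
    volume {x : ι → ℝ | x ∈ Set.pi Set.univ (fun _ : ι => Set.Icc (0 : ℝ) 1) ∧ sahiE (weight x) k (fun j => ind (U j)) = 0} = 0 := by
  rcases isEmpty_or_nonempty ι with hι | hι
  · obtain ⟨x₀, -, hx₀⟩ := hne
    have hempty : {x : ι → ℝ | x ∈ Set.pi Set.univ (fun _ : ι => Set.Icc (0 : ℝ) 1) ∧
        sahiE (weight x) k (fun j => ind (U j)) = 0} = ∅ := by
      ext x
      simp only [Set.mem_setOf_eq, Set.mem_empty_iff_false, iff_false, not_and]
      intro _ h0
      have hx : x = x₀ := funext fun e => (hι.false e).elim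
      rw [hx] at h0
      exact hx₀ h0
    rw [hempty]; exact measure_empty
  · have hne' : ∃ x ∈ Set.pi Set.univ (fun _ : ι => Set.Icc (0 : ℝ) 1),
        MvPolynomial.eval x (sahiEPoly k (fun j => ind (U j))) ≠ 0 := by
      obtain ⟨x, hx, hx0⟩ := hne
      exact ⟨x, hx, by rwa [eval_sahiEPoly_ind']⟩
    have h := volume_cube_zeroSet_eq_zero' _ hne'
    have hset : {x : ι → ℝ | x ∈ Set.pi Set.univ (fun _ : ι => Set.Icc (0 : ℝ) 1) ∧ sahiE (weight x) k (fun j => ind (U j)) = 0} =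
        {x : ι → ℝ | x ∈ Set.pi Set.univ (fun _ : ι => Set.Icc (0 : ℝ) 1) ∧
          MvPolynomial.eval x (sahiEPoly k (fun j => ind (U j))) = 0} := by
      ext x; simp only [Set.mem_setOf_eq, eval_sahiEPoly_ind']
    rw [hset]; exact h

/-- **Increasing `U ∉ Z_k` on any finite `ι`: the zero set of `x ↦ E_k(μ_x; 1_U)` in `[0,1]^ι` is Lebesgue-null.** [this work] -/
theorem volume_cube_sahiE_zeroSet_eq_zero' {k : ℕ} (U : Fin k → Set (Set ι)) (hU : ∀ j, IsUpperSet (U j)) (hZ : ¬ SuppZeroFlag k U) :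
    volume {x : ι → ℝ | x ∈ Set.pi Set.univ (fun _ : ι => Set.Icc (0 : ℝ) 1) ∧ sahiE (weight x) k (fun j => ind (U j)) = 0} = 0 := by
  refine volume_cube_sahiE_zeroSet_eq_zero_of_exists U ?_
  by_contra hall
  push Not at hall
  refine hZ ((GluedFrames.masterFamilyIdentEqIff_all k ι U hU).1 fun p _ => ?_)
  exact hall (fun e => (p e : ℝ)) (Set.mem_univ_pi.2 fun e => (p e).2)

/-- **Decreasing `D ∉ Z_k` on any finite `ι`: the zero set of `x ↦ E_k(μ_x; 1_D)` in `[0,1]^ι` is Lebesgue-null.** [this work] -/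
theorem volume_cube_sahiE_lower_zeroSet_eq_zero {k : ℕ} (D : Fin k → Set (Set ι)) (hD : ∀ j, IsLowerSet (D j))
    (hZ : ¬ SuppZeroFlag k D) :
    volume {x : ι → ℝ | x ∈ Set.pi Set.univ (fun _ : ι => Set.Icc (0 : ℝ) 1) ∧ sahiE (weight x) k (fun j => ind (D j)) = 0} = 0 := by
  refine volume_cube_sahiE_zeroSet_eq_zero_of_exists D ?_
  by_contra hall
  push Not at hall
  refine hZ ((sahiE_ind_lower_identically_zero_iff D hD).1 fun p _ => ?_)
  exact hall (fun e => (p e : ℝ)) (Set.mem_univ_pi.2 fun e => (p e).2)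

/-- A.e. form, one family of events with the zero-flag direction `Z_k ⟹ E_k = 0` (any events). [this work] -/
theorem ae_sahiE_eq_zero_iff_of_null {k : ℕ} (U : Fin k → Set (Set ι))
    (h : ¬ SuppZeroFlag k U →
      volume {x : ι → ℝ | x ∈ Set.pi Set.univ (fun _ : ι => Set.Icc (0 : ℝ) 1) ∧ sahiE (weight x) k (fun j => ind (U j)) = 0} = 0) :
    ∀ᵐ x ∂(volume : Measure (ι → ℝ)), x ∈ Set.pi Set.univ (fun _ : ι => Set.Icc (0 : ℝ) 1) →
      (sahiE (weight x) k (fun j => ind (U j)) = 0 ↔ SuppZeroFlag k U) := by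
  by_cases hZ : SuppZeroFlag k U
  · refine Filter.Eventually.of_forall fun x hx => ⟨fun _ => hZ, fun _ => ?_⟩
    have hx' : ∀ e, x e ∈ Set.Icc (0 : ℝ) 1 := fun e => Set.mem_univ_pi.1 hx e
    exact masterFamilyEqIff_mpr k ι (fun e => ⟨x e, hx' e⟩) U hZ
  · rw [ae_iff]
    refine measure_mono_null (fun x hx => ?_) (h hZ)
    simp only [Set.mem_setOf_eq, Classical.not_imp] at hx
    refine ⟨hx.1, ?_⟩
    by_contra h0
    exact hx.2 ⟨fun h => absurd h h0, fun h => absurd h hZ⟩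

/-- **For a.e. `x ∈ [0,1]^ι`, every increasing `k`-family has `E_k(μ_x; 1_U) = 0 ↔ U ∈ Z_k`.** [this work] -/
theorem ae_forall_sahiE_eq_zero_iff' (k : ℕ) :
    ∀ᵐ x ∂(volume : Measure (ι → ℝ)), x ∈ Set.pi Set.univ (fun _ : ι => Set.Icc (0 : ℝ) 1) →
      ∀ U : Fin k → Set (Set ι), (∀ j, IsUpperSet (U j)) → (sahiE (weight x) k (fun j => ind (U j)) = 0 ↔ SuppZeroFlag k U) := by
  have h : ∀ U : Fin k → Set (Set ι), ∀ᵐ x ∂(volume : Measure (ι → ℝ)),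
      x ∈ Set.pi Set.univ (fun _ : ι => Set.Icc (0 : ℝ) 1) → (∀ j, IsUpperSet (U j)) →
        (sahiE (weight x) k (fun j => ind (U j)) = 0 ↔ SuppZeroFlag k U) := by
    intro U
    by_cases hU : ∀ j, IsUpperSet (U j)
    · exact (ae_sahiE_eq_zero_iff_of_null U (volume_cube_sahiE_zeroSet_eq_zero' U hU)).mono fun x hx hcube _ => hx hcube
    · exact Filter.Eventually.of_forall fun x _ hU' => absurd hU' hU
  exact (ae_all_iff.2 h).mono fun x hx hcube U hU => hx U hcube hU

/-- **For a.e. `x ∈ [0,1]^ι`, every DECREASING `k`-family has `E_k(μ_x; 1_D) = 0 ↔ D ∈ Z_k`.** [this work] -/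
theorem ae_forall_sahiE_lower_eq_zero_iff (k : ℕ) :
    ∀ᵐ x ∂(volume : Measure (ι → ℝ)), x ∈ Set.pi Set.univ (fun _ : ι => Set.Icc (0 : ℝ) 1) →
      ∀ D : Fin k → Set (Set ι), (∀ j, IsLowerSet (D j)) → (sahiE (weight x) k (fun j => ind (D j)) = 0 ↔ SuppZeroFlag k D) := by
  have h : ∀ D : Fin k → Set (Set ι), ∀ᵐ x ∂(volume : Measure (ι → ℝ)),
      x ∈ Set.pi Set.univ (fun _ : ι => Set.Icc (0 : ℝ) 1) → (∀ j, IsLowerSet (D j)) →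
        (sahiE (weight x) k (fun j => ind (D j)) = 0 ↔ SuppZeroFlag k D) := by
    intro D
    by_cases hD : ∀ j, IsLowerSet (D j)
    · exact (ae_sahiE_eq_zero_iff_of_null D (volume_cube_sahiE_lower_zeroSet_eq_zero D hD)).mono fun x hx hcube _ => hx hcube
    · exact Filter.Eventually.of_forall fun x _ hD' => absurd hD' hD
  exact (ae_all_iff.2 h).mono fun x hx hcube D hD => hx D hcube hD

end Pointwise

/-! ### Graph form: almost every edge-weight vector -/

namespace Pointwise

open Literature.Probability.Percolation

variable {V : Type} [Fintype V]

/-- **For almost every edge-weight vector of a finite graph, `E_k` of a `k`-tuple of group separations vanishes iff the tuple is a zero flag**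
(simultaneously for all tuples; Lebesgue measure on `[0,1]^{Sym2 V}`, real weights `w` with the product weight `weight w`). [this work] -/
theorem ae_forall_groupSep_sahiE_eq_zero_iff (k : ℕ) :
    ∀ᵐ w ∂(volume : Measure (Sym2 V → ℝ)), w ∈ Set.pi Set.univ (fun _ : Sym2 V => Set.Icc (0 : ℝ) 1) →
      ∀ X Y : Fin k → Set V,
        sahiE (weight w) k (fun j => ind {ω : BondConfig V | ∀ x ∈ X j, ∀ y ∈ Y j, ¬ (openGraph ω).Reachable x y}) = 0 ↔
          SuppZeroFlag k fun j => {ω : BondConfig V | ∀ x ∈ X j, ∀ y ∈ Y j, ¬ (openGraph ω).Reachable x y} :=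
  (ae_forall_sahiE_lower_eq_zero_iff (ι := Sym2 V) k).mono fun _ hw hcube X Y =>
    hw hcube _ fun j => isLowerSet_groupSep (X j) (Y j)

end Pointwise

end Summit.CriticalPhenomena.PercolationContinuityZ3.Theorems
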